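import Summits.Ventures.HodgeRepro0.P6AokiQuotientLevel180Data4

/-!
# Aoki's quotient `B_q/(S_q + D_q)` at the level q = 180 — kernel certificate (part 8 of 15 — the rows 39 … 57 of `hℓexpr`)

The kernel-decided fact `hℓexpr` of `level_of_decided` on the rows `39 … 57` of the echelon basis (rows `39 + i`, `i < 19`).
-/

namespace HodgeRepro0.P6AokiQuotient

namespace L180
/-- level 180: the rows `39 + i`, `i < 19`, of the kernel-decided fact `hℓexpr`. -/
theorem fact_hellexpr_2 : ∀ i < 19, ellL.getD (39 + i) [] = lincombList (180 - 1) (List.zip (exprG.getD (39 + i) []) (exprC.getD (39 + i) [])) (genDenseL ++ betaL) := by decide +kernel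
end L180

end HodgeRepro0.P6AokiQuotient
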